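import Mathlib

/-!
# From an eventual lower pin at rate `C₁` to a frequently-violated certificate at every rate `ε > C₁`

Bookkeeping for line `Sketch` of crux `PauliWegnerSea.ChiralOneScaleTrajectory`
(stmt-QuantumFields-17512), card one-volume-goldstone-witness item 2 ("the new conjunct is the
statement that the package's rate function has no floor as `m → 0⁺`").

Clause (iii) of the crux is an EVENTUAL (in the cutoff index `k`) lower bound
`c₀ e^{-(C₁ a_k n + p log(n+1))} ≤ F(k, S, n)` for ALL volumes `S ≥ L_k` and distances `n ≤ S`, on
some functional `F` of the regularisation (there: the `|det|`-weighted fractional moment of the quark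
propagator).  The pins consumed by the transfer stub `stub_chiralityTransfer` have the dual shape
`∀ C, ∃ᶠ k, ∃ S ≥ L_k, ∃ n ≤ S, C e^{-ε a_k n} < F(k, S, n)`.  The elementary lemma
`frequently_violation_of_eventual_lowerPin` below says the first implies the second for every rate
`ε > C₁`: at fixed `k` the ratio `e^{(ε - C₁) a_k n} (n+1)^{-p}` is unbounded in `n` (exponentials
beat powers, `a_k > 0`), and the clause leaves `S = n` free.  Hence the chirality conjunct at
`N_f = 2` costs exactly `inf_m C₁(m, m)/s(m) = 0` in the constants of (iii) (with the Jensen and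
`N_f = 2` bridges and the transfer).  Pure real analysis; folklore.
-/

namespace Summit.QuantumFields.QCD.Cruxes.ChiralOneScaleTrajectory.GoldstoneWitness

open Filter Real

/-- Exponentials beat powers along the naturals: for `δ > 0` and any real `p`, `C`, eventually in
`n : ℕ`, `C < c₀ · e^{δ n} · (n+1)^{-p}` whenever `c₀ > 0`. [folklore] -/
theorem eventually_lt_mul_exp_mul_rpow {δ c₀ : ℝ} (hδ : 0 < δ) (hc₀ : 0 < c₀) (p C : ℝ) :
    ∀ᶠ n : ℕ in atTop, C < c₀ * Real.exp (δ * n) * ((n : ℝ) + 1) ^ (-p) := by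
  -- `e^{δ x} / x^p → ∞` along the reals, composed with `n ↦ n + 1` and rescaled
  have h1 : Tendsto (fun x : ℝ => Real.exp (δ * x) / x ^ p) atTop atTop :=
    tendsto_exp_mul_div_rpow_atTop p δ hδ
  have h2 : Tendsto (fun n : ℕ => ((n : ℝ) + 1)) atTop atTop :=
    tendsto_atTop_add_const_right _ 1 tendsto_natCast_atTop_atTop
  have h3 : Tendsto (fun n : ℕ => Real.exp (δ * ((n : ℝ) + 1)) / ((n : ℝ) + 1) ^ p) atTop atTop :=
    h1.comp h2
  have h4 : Tendsto (fun n : ℕ => (c₀ * Real.exp (-δ)) *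
      (Real.exp (δ * ((n : ℝ) + 1)) / ((n : ℝ) + 1) ^ p)) atTop atTop :=
    h3.const_mul_atTop (mul_pos hc₀ (Real.exp_pos _))
  refine (h4.eventually_gt_atTop C).mono fun n hn => ?_
  have hn0 : (0 : ℝ) < (n : ℝ) + 1 := by positivity
  calc C < c₀ * Real.exp (-δ) * (Real.exp (δ * ((n : ℝ) + 1)) / ((n : ℝ) + 1) ^ p) := hn
    _ = c₀ * Real.exp (δ * n) * ((n : ℝ) + 1) ^ (-p) := by
        rw [Real.rpow_neg hn0.le, mul_add, mul_one, Real.exp_add, div_eq_mul_inv, Real.exp_neg]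
        have hδ0 : Real.exp δ ≠ 0 := (Real.exp_pos δ).ne'
        field_simp

/-- **Eventual lower pin at rate `C₁` ⇒ frequently-violated certificate at every rate `ε > C₁`.**
If, eventually in `k`, `c₀ e^{-(C₁ a_k n + p log(n+1))} ≤ F k S n` for all `S ≥ L_k` and `n ≤ S`
(`c₀ > 0`, `a_k > 0`), then for every `ε > C₁` and every constant `C`, frequently in `k` there are
`S ≥ L_k` and `n ≤ S` with `C e^{-ε a_k n} < F k S n` (take `S = max(L_k, n)` with `n` large at
fixed `k`). The shape of clause (iii) of `ChiralOneScaleTrajectory` on the left, the shape of the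
pins of `stub_chiralityTransfer` / `signedPin_of_unsignedPin_two` on the right. [folklore] -/
theorem frequently_violation_of_eventual_lowerPin :
    ∀ (a : ℕ → ℝ) (L : ℕ → ℕ) (F : ℕ → ℕ → ℕ → ℝ) (c₀ C₁ p ε : ℝ), (∀ k, 0 < a k) → 0 < c₀ → C₁ < ε → (∀ᶠ k in Filter.atTop, ∀ S : ℕ, L k ≤ S → ∀ n : ℕ, n ≤ S → c₀ * Real.exp (-(C₁ * (a k * n) + p * Real.log (n + 1))) ≤ F k S n) → ∀ C : ℝ, ∃ᶠ k in Filter.atTop, ∃ S : ℕ, L k ≤ S ∧ ∃ n : ℕ, n ≤ S ∧ C * Real.exp (-(ε * (a k * n))) < F k S n := by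
  intro a L F c₀ C₁ p ε ha hc₀ hε h C
  refine Eventually.frequently (h.mono fun k hk => ?_)
  have hδ : 0 < (ε - C₁) * a k := mul_pos (sub_pos.2 hε) (ha k)
  obtain ⟨n, hn⟩ := ((eventually_lt_mul_exp_mul_rpow hδ hc₀ p C).and
    (eventually_ge_atTop (L k))).exists
  obtain ⟨hnC, hnL⟩ := hn
  refine ⟨n, hnL, n, le_rfl, ?_⟩
  have hlow := hk n hnL n le_rfl
  refine lt_of_lt_of_le ?_ hlow
  -- `C e^{-ε a n} < c₀ e^{-(C₁ a n + p log(n+1))}` ⟸ `C < c₀ e^{(ε-C₁) a n} (n+1)^{-p}`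
  have hn0 : (0 : ℝ) < (n : ℝ) + 1 := by positivity
  have hexp : Real.exp (-(C₁ * (a k * n) + p * Real.log (n + 1))) =
      Real.exp (-(ε * (a k * n))) * (Real.exp ((ε - C₁) * a k * n) * ((n : ℝ) + 1) ^ (-p)) := by
    rw [Real.rpow_def_of_pos hn0, ← Real.exp_add, ← Real.exp_add]
    congr 1
    ring
  have hpos : 0 < Real.exp (-(ε * (a k * n))) := Real.exp_pos _
  have key : C * Real.exp (-(ε * (a k * n))) <
      (c₀ * Real.exp ((ε - C₁) * a k * n) * ((n : ℝ) + 1) ^ (-p)) * Real.exp (-(ε * (a k * n))) :=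
    mul_lt_mul_of_pos_right hnC hpos
  calc C * Real.exp (-(ε * (a k * ↑n)))
      < (c₀ * Real.exp ((ε - C₁) * a k * n) * ((n : ℝ) + 1) ^ (-p)) * Real.exp (-(ε * (a k * n))) := key
    _ = c₀ * Real.exp (-(C₁ * (a k * n) + p * Real.log (n + 1))) := by rw [hexp]; ring

end Summit.QuantumFields.QCD.Cruxes.ChiralOneScaleTrajectory.GoldstoneWitness
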